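import Literature.Topology.FourManifolds.ModifiedFibreCoordinate
import Literature.Topology.FourManifolds.ModifiedFibreDistance
import HarnessLib

/-!
# The distance function of one family of the middle-level configuration, in chart position
# near the crossings

Topic `Literature/Topology/FourManifolds` (fact seat
`provefact-Literature.Topology.FourManifolds.Matvey-69322e0896`, rung (H4)
`Literature.Topology.FourManifolds.Matveyev1996_partOne_and_fact_of_dualSpheres` of
`CorkDecompositionMiddleLevel.lean`).  Third step of the construction of the regular
neighbourhood `V₀ = Nd_N(S_* ∪ P_*)` of the middle-level configuration of the cork
decomposition theorem (Matveyev 1996, arXiv:dg-ga/9505001, p. 1; Kirby 1996,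
arXiv:math/9712231, §3) as a regular sublevel set: the tubes about all the spheres of ONE
framed family `S` are presented by a single smooth function `H_S : N → ℝ` — zero set the
union of the core spheres, no critical points on the levels `0 < H_S < τ`, the constant `τ`
off the tubes — which near each of finitely many marked points (the crossings with the other
family) is the squared norm `‖Ψ_c,₂‖²` of the second coordinate of a prescribed chart `Ψ_c`
(the adapted chart of `PlumbingAdaptedChartNormalised.lean`, in which the sphere through `c`
is the plane `{Ψ_c,₂ = 0}`; Milnor, *Lectures on the h-cobordism theorem* (1965), PDF p. 27).
It is assembled from the modified fibre coordinates of `ModifiedFibreCoordinate.lean` and the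
clamped squared fibre distances of `ModifiedFibreDistance.lean`, one for each sphere, with a
common plateau value `τ`.  Everything is proved; no definitions, no named facts:

* `Literature.Topology.FourManifolds.FramedSphereFamily.exists_familyDistance` — for a finite
  framed family `S` in a Hausdorff manifold, finitely many charts `Ψ_c : N ⇀ ℝᵃ × ℝᵇ` smooth
  on their domains and smooth functions `χ_c` with `tsupport χ_c ⊆ (Ψ_c).source`, such that
  wherever a core sphere `Sᵢ` meets `tsupport χ_c` one has `Ψ_c,₂(Sᵢ x) = 0` and the
  normalisation `d(w ↦ Ψ_c,₂(φᵢ(x, w)))_0 = id`: there are a `C^∞` function `H_S : N → ℝ`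
  and `τ > 0` with `0 ≤ H_S`, `H_S z = 0 ↔ z ∈ ⋃ᵢ Sᵢ`, `{H_S < τ} ⊆ ⋃ᵢ φᵢ(Sᵃ × ℝᵇ)`, no
  critical points where `0 < H_S < τ`, and `H_S = ‖Ψ_c,₂‖²` near every point of the cores at
  which `χ_c ≡ 1` and the other `χ_c'` vanish identically nearby.

## References

* R. Matveyev, *A decomposition of smooth simply-connected h-cobordant 4-manifolds*,
  J. Differential Geom. 44 (1996) 571–582; arXiv:dg-ga/9505001, Proof of Theorem, p. 1.
  [Matveyev1996]
* R. Kirby, *Akbulut's corks and h-cobordisms of smooth, simply connected 4-manifolds*, Turkish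
  J. Math. 20 (1996) 85–93; arXiv:math/9712231, §3. [KirbyCorks1996]
* J. Milnor, *Lectures on the h-cobordism theorem*, Princeton (1965), Def. 3.9 (PDF p. 16),
  PDF p. 27. [MilnorHCobordism1965]
* M. W. Hirsch, *Differential Topology*, GTM 33 (1976), Ch. 4 §5. [HirschDT1976]
-/

open scoped Manifold ContDiff Topology
open Set Function Filter

noncomputable section

namespace Literature.Topology.FourManifolds

universe u v w

namespace FramedSphereFamily

variable {n a b : ℕ} {N : Type u} [TopologicalSpace N] [T2Space N]
  [ChartedSpace (EuclideanSpace ℝ (Fin n)) N] {ι : Type v} [Finite ι]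

/-- **The distance function of one family, in chart position near the crossings.**  Let `S`
be a finite framed family of `a`-spheres with `b`-dimensional fibre in the Hausdorff manifold
`N`, and let `Ψ_c : N ⇀ ℝᵃ × ℝᵇ` (`c ∈ C`, finite) be charts, smooth on their domains, with
smooth functions `χ_c : N → ℝ`, `tsupport χ_c ⊆ (Ψ_c).source`, such that at every point
`Sᵢ(x)` of `tsupport χ_c`: `Ψ_c,₂(Sᵢ x) = 0`, and `d(w ↦ Ψ_c,₂(φᵢ(x, w)))_0 = id` (adapted
charts at the crossings with bumps concentrated there).  Then there are a `C^∞` function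
`H_S : N → ℝ` and a number `τ > 0` such that: `0 ≤ H_S`; `H_S z = 0 ↔ z` lies on one of the
core spheres; `H_S z < τ` only inside the tubes `φᵢ(Sᵃ × ℝᵇ)`; `H_S` has no critical point
where `0 < H_S < τ`; and near every point `z` of the cores at which `χ_c ≡ 1` and all the
other `χ_c'` vanish identically nearby, `H_S = ‖Ψ_c,₂‖²`.  Construction: for each sphere the
modified fibre coordinate `Fᵢ` (`exists_modifiedFibreCoordinate`) and its clamped squared
fibre distance `Hᵢ` with a common plateau `τ` (the least of the thresholds of
`exists_clampedFibreDistance`), and `H_S = τ + Σᵢ (Hᵢ - τ)`, which is `Hᵢ` on the `i`-th tube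
(the tubes being disjoint) and `τ` off the tubes.  This presents `Nd_N(S_*)`, bent into chart
position at the crossings with `P_*` (Matveyev 1996, p. 1; Kirby 1996, §3; Milnor 1965,
PDF p. 27).
[cite: Matveyev1996, Proof of Theorem (arXiv p. 1)] [cite: KirbyCorks1996, §3]
[cite: MilnorHCobordism1965, Def. 3.9 (PDF p. 16), PDF p. 27] -/
theorem exists_familyDistance (S : FramedSphereFamily (𝓡 n) N ι a b)
    {C : Type w} [Fintype C]
    (Ψ : C → OpenPartialHomeomorph N (EuclideanSpace ℝ (Fin a) × EuclideanSpace ℝ (Fin b)))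
    (χ : C → N → ℝ)
    (hΨ : ∀ c, ContMDiffOn (𝓡 n) 𝓘(ℝ, EuclideanSpace ℝ (Fin a) × EuclideanSpace ℝ (Fin b)) ∞
      (Ψ c) (Ψ c).source)
    (hχ : ∀ c, ContMDiff (𝓡 n) 𝓘(ℝ, ℝ) ∞ (χ c))
    (hsupp : ∀ c, tsupport (χ c) ⊆ (Ψ c).source)
    (hplane : ∀ c i x, S.sphere i x ∈ tsupport (χ c) → (Ψ c (S.sphere i x)).2 = 0)
    (hnorm : ∀ c i x, S.sphere i x ∈ tsupport (χ c) →
      HasFDerivAt (fun w : EuclideanSpace ℝ (Fin b) => (Ψ c (S.toFun i (x, w))).2)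
        (ContinuousLinearMap.id ℝ (EuclideanSpace ℝ (Fin b))) 0) :
    ∃ (HS : N → ℝ) (τ : ℝ), 0 < τ ∧ ContMDiff (𝓡 n) 𝓘(ℝ, ℝ) ∞ HS ∧
      (∀ z, 0 ≤ HS z) ∧
      (∀ z, HS z = 0 ↔ z ∈ S.cores) ∧
      (∀ z, HS z < τ → ∃ i, z ∈ range (S.toFun i)) ∧
      (∀ z, 0 < HS z → HS z < τ → ¬ IsMCriticalPt (𝓡 n) HS z) ∧
      (∀ c, ∀ z ∈ S.cores, χ c =ᶠ[𝓝 z] (fun _ => (1 : ℝ)) →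
        (∀ c', c' ≠ c → χ c' =ᶠ[𝓝 z] fun _ => (0 : ℝ)) →
        HS =ᶠ[𝓝 z] fun z => ‖(Ψ c z).2‖ ^ 2) := by
  classical
  haveI := Fintype.ofFinite ι
  -- per sphere: the modified fibre coordinate and the clamping threshold
  have hper : ∀ i, ∃ (F : N → EuclideanSpace ℝ (Fin b)) (τ₀ : ℝ), 0 < τ₀ ∧
      (∀ c z, χ c z = 1 → (∀ c', c' ≠ c → χ c' z = 0) → F z = (Ψ c z).2) ∧
      ∀ τ : ℝ, 0 < τ → τ ≤ τ₀ →
        ∃ H : N → ℝ, ContMDiff (𝓡 n) 𝓘(ℝ, ℝ) ∞ H ∧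
          (∀ z, 0 ≤ H z) ∧
          (∀ z, z ∉ range (S.toFun i) → H z = τ) ∧
          (∀ z, H z = 0 ↔ z ∈ range (S.sphere i)) ∧
          (∀ z, H z < τ → H =ᶠ[𝓝 z] fun z => ‖F z‖ ^ 2) ∧
          (∀ z, 0 < H z → H z < τ → ¬ IsMCriticalPt (𝓡 n) H z) := by
    intro i
    obtain ⟨F, hF, hF0, hFd, hFc, -⟩ := S.exists_modifiedFibreCoordinate i Ψ χ hΨ hχ hsupp
      (fun c x hx => hplane c i x hx) (fun c x hx => hnorm c i x hx)
    obtain ⟨τ₀, hτ₀, hH⟩ := S.exists_clampedFibreDistance i hF hF0 hFd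
    exact ⟨F, τ₀, hτ₀, hFc, hH⟩
  choose F τ₀ hτ₀ hFc hH using hper
  -- the empty family
  rcases isEmpty_or_nonempty ι with hι | hι
  · refine ⟨fun _ => 1, 1, one_pos, contMDiff_const, fun _ => zero_le_one, fun z => ?_,
      fun z hz => absurd hz (lt_irrefl _), fun z _ h1 => absurd h1 (lt_irrefl _),
      fun c z hz => ?_⟩
    · refine ⟨fun h => absurd h one_ne_zero, fun hz => ?_⟩
      obtain ⟨i, -, -⟩ := S.mem_cores_iff.1 hz
      exact isEmptyElim i
    · obtain ⟨i, -, -⟩ := S.mem_cores_iff.1 hz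
      exact isEmptyElim i
  -- a common plateau `τ`
  obtain ⟨i₀, hi₀⟩ := Finite.exists_min τ₀
  set τ := τ₀ i₀ with hτ_def
  have hτ : 0 < τ := hτ₀ i₀
  have hH' := fun i => hH i τ hτ (hi₀ i)
  choose H hHs hH0 hHτ hHz hHloc hHreg using hH'
  -- the family function `H_S = τ + Σᵢ (Hᵢ - τ)`
  set HS : N → ℝ := fun z => τ + ∑ i, (H i z - τ) with hHS_def
  have hdisj : ∀ {i j : ι} {z : N}, z ∈ range (S.toFun i) → z ∈ range (S.toFun j) → i = j := by
    intro i j z hi hj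
    by_contra hij
    exact Set.disjoint_left.1 (S.disjoint_range hij) hi hj
  have hval : ∀ i z, z ∈ range (S.toFun i) → HS z = H i z := by
    intro i z hz
    have h1 : ∑ j, (H j z - τ) = H i z - τ := by
      refine Finset.sum_eq_single i (fun j _ hj => ?_) fun h => absurd (Finset.mem_univ i) h
      rw [hHτ j z fun hz' => hj (hdisj hz' hz), sub_self]
    simp only [hHS_def, h1]
    ring
  have hval' : ∀ z, (∀ i, z ∉ range (S.toFun i)) → HS z = τ := by
    intro z hz
    have h1 : ∑ j, (H j z - τ) = 0 :=
      Finset.sum_eq_zero fun j _ => by rw [hHτ j z (hz j), sub_self]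
    simp only [hHS_def, h1, add_zero]
  have hsmooth : ContMDiff (𝓡 n) 𝓘(ℝ, ℝ) ∞ HS :=
    contMDiff_const.add (ContMDiff.sum fun i _ => (hHs i).sub contMDiff_const)
  have hlt : ∀ z, HS z < τ → ∃ i, z ∈ range (S.toFun i) := by
    intro z hz
    by_contra h
    push Not at h
    rw [hval' z h] at hz
    exact lt_irrefl _ hz
  have hloc : ∀ i z, z ∈ range (S.toFun i) → HS =ᶠ[𝓝 z] H i := fun i z hz => by
    filter_upwards [(S.isOpen_range i).mem_nhds hz] with y hy using hval i y hy
  refine ⟨HS, τ, hτ, hsmooth, fun z => ?_, fun z => ?_, hlt, fun z h0 h1 => ?_,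
    fun c z hz h1 h0 => ?_⟩
  · -- `0 ≤ H_S`
    by_cases h : ∃ i, z ∈ range (S.toFun i)
    · obtain ⟨i, hi⟩ := h
      rw [hval i z hi]
      exact hH0 i z
    · push Not at h
      rw [hval' z h]
      exact hτ.le
  · -- the zero set is the union of the core spheres
    constructor
    · intro hz
      obtain ⟨i, hi⟩ := hlt z (by rw [hz]; exact hτ)
      rw [hval i z hi] at hz
      obtain ⟨x, hx⟩ := (hHz i z).1 hz
      exact S.mem_cores_iff.2 ⟨i, x, hx⟩
    · intro hz
      obtain ⟨i, x, rfl⟩ := S.mem_cores_iff.1 hz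
      have hi : S.sphere i x ∈ range (S.toFun i) := ⟨(x, 0), (S.sphere_apply i x).symm⟩
      rw [hval i _ hi]
      exact (hHz i _).2 (mem_range_self x)
  · -- no critical points where `0 < H_S < τ`
    obtain ⟨i, hi⟩ := hlt z h1
    rw [hval i z hi] at h0 h1
    intro hc
    refine hHreg i z h0 h1 ?_
    unfold IsMCriticalPt at hc ⊢
    rwa [(hloc i z hi).mfderiv_eq] at hc
  · -- near a marked point of the cores: `H_S = ‖Ψ_c,₂‖²`
    obtain ⟨i, x, rfl⟩ := S.mem_cores_iff.1 hz
    have hi : S.sphere i x ∈ range (S.toFun i) := ⟨(x, 0), (S.sphere_apply i x).symm⟩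
    have hHi0 : H i (S.sphere i x) = 0 := (hHz i _).2 (mem_range_self x)
    have h2 : H i =ᶠ[𝓝 (S.sphere i x)] fun z => ‖F i z‖ ^ 2 := hHloc i _ (by rw [hHi0]; exact hτ)
    have hall : ∀ᶠ y in 𝓝 (S.sphere i x), χ c y = 1 ∧ ∀ c', c' ≠ c → χ c' y = 0 := by
      refine h1.and (eventually_all.2 fun c' => ?_)
      by_cases hc' : c' = c
      · exact Eventually.of_forall fun y h => absurd hc' h
      · exact (h0 c' hc').mono fun y hy _ => hy
    have h3 : (fun z => ‖F i z‖ ^ 2) =ᶠ[𝓝 (S.sphere i x)] fun z => ‖(Ψ c z).2‖ ^ 2 :=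
      hall.mono fun y hy => by
        show ‖F i y‖ ^ 2 = ‖(Ψ c y).2‖ ^ 2
        rw [hFc i c y hy.1 hy.2]
    exact ((hloc i _ hi).trans h2).trans h3

end FramedSphereFamily

end Literature.Topology.FourManifolds

end
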